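import Summits.CriticalPhenomena.PercolationContinuityZ3.Theses.PercNearOneGluing
import Literature.Probability.Percolation.PercolationEvents
import HarnessLib.Audit
import Literature.Probability.LatticeModels.ProdBernoulliIndependence
import Literature.Probability.Percolation.PercolationProofs
import Literature.Probability.Percolation.TwoClusterConditionalAssociation
import Literature.Probability.Percolation.TwoClusterConditionalAssociationProofs
import Summits.CriticalPhenomena.PercolationContinuityZ3.Theorems.PercNearOneGluingAdditiveGluingTieLiftTwoAux
import Summits.CriticalPhenomena.PercolationContinuityZ3.Theorems.PercNearOneGluingAdditiveGluingPocketBHKCov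

/-! TTRL-lite variant V2455 of stmt-CriticalPhenomena-4574

(`stub_shorteningStep` of line `kn_shortening_induction`, move `small_case+small_case`:
`A.card = 2` and `n ≤ 5`).  In fact we prove Kozma–Nitzan's Conjecture 6 (arXiv:2401.12397, §5.3
p. 34, the "shortening step") for TWO relays on an arbitrary finite weighted graph: the bound
`n ≤ 5`, the induction hypothesis, `w s(v,x) = 0` and `v ∉ A` are not used.

Write `μ = prodBernoulli w`, `μ' = prodBernoulli (w[s(v,x) ↦ 1])`, `A = {a₀, a₁}`,
`S = {v, x}`, and `{S ↔ y} = {y ↔ v} ∪ {y ↔ x}`.  Since `μ'` is the image of `μ` under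
`ω ↦ insert s(v,x) ω` (`tieLiftTwo_real_update_one`) and a path of `insert s(v,x) ω` either
avoids the glued pair or decomposes at it (`knConj6Two_reachable_insert`),
`μ'(v ↔ A) ≤ μ(SA)`, `μ'(a₀ ↔ b) ≤ μ(G₀)`, `μ(Sb) ≤ μ'(v ↔ b)` with the increasing events
`SA = {S ↔ a₀} ∪ {S ↔ a₁}`, `G₀ = {a₀ ↔ b} ∪ ({S ↔ a₀} ∩ {S ↔ b})`, `Sb = {S ↔ b}`.  Harris gives
`μ(SA) μ(G₀) ≤ μ(SA ∩ G₀)`, and the heart of the matter is `μ(SA ∩ G₀) ≤ μ(SA ∩ Sb)`: the two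
events differ by `N = D ∩ {a₀ ↔ b} ∩ H ∩ Qᶜ` versus (a superset of) `M = D ∩ {a₁ ↔ b} ∩ H ∩ Qᶜ`
(`D = {a₀ ↮ a₁}`, `H = {S ↔ a₁}`, `Q = {S ↔ a₀}`), and `μ(N) ≤ μ(M)` follows from the minimiser
hypothesis `μ(a₀ ↔ b) ≤ μ(a₁ ↔ b)` (in the UNGLUED measure) by two applications of the
van den Berg–Häggström–Kahn two-cluster inequality (BHK 2006 Thm 1.5, proved in the tree):
negative correlation of `1{a₀ ↔ b}` (increasing in `C_{a₀}`) with `1_H · 1_{Qᶜ}` (increasing in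
`C_{a₁}`, decreasing in `C_{a₀}`) given `D`, and positive association of `1{a₁ ↔ b}` with
`1_H · 1_{Qᶜ}` given `D`.  No new definitions, no named facts. -/

namespace Summit.CriticalPhenomena.PercolationContinuityZ3.Theorems

open MeasureTheory Set Literature.Probability.LatticeModels Literature.Probability.Percolation
open scoped Classical BigOperators

section GraphLemmas

variable {V : Type*}

/-- Paths after gluing: if `a ↔ b` in `insert s(v,x) ω`, then either `a ↔ b` in `ω`, or both `a`
and `b` are joined in `ω` to the pair `{v, x}`. [folklore] -/
theorem knConj6Two_reachable_insert (ω : BondConfig V) (v x b : V) {a : V}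
    (h : (openGraph (insert s(v, x) ω)).Reachable a b) :
    (openGraph ω).Reachable a b ∨
      (((openGraph ω).Reachable a v ∨ (openGraph ω).Reachable a x) ∧
        ((openGraph ω).Reachable b v ∨ (openGraph ω).Reachable b x)) := by
  obtain ⟨p⟩ := h
  induction p with
  | nil => exact Or.inl (SimpleGraph.Reachable.refl _)
  | @cons u u' z hadj p ih =>
    obtain ⟨hmem, hne⟩ := (openGraph_adj _ _ _).1 hadj
    rcases Set.mem_insert_iff.1 hmem with heq | hω
    · -- the step uses the glued pair: `{u, u'} = {v, x}`
      have hz : (openGraph ω).Reachable z v ∨ (openGraph ω).Reachable z x := by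
        rcases ih with hzr | ⟨_, hzr⟩
        · rcases Sym2.eq_iff.1 heq with ⟨_, rfl⟩ | ⟨_, rfl⟩
          · exact Or.inr hzr.symm
          · exact Or.inl hzr.symm
        · exact hzr
      refine Or.inr ⟨?_, hz⟩
      rcases Sym2.eq_iff.1 heq with ⟨rfl, _⟩ | ⟨rfl, _⟩
      · exact Or.inl (SimpleGraph.Reachable.refl _)
      · exact Or.inr (SimpleGraph.Reachable.refl _)
    · have hadj' : (openGraph ω).Adj u u' := (openGraph_adj ω u u').2 ⟨hω, hne⟩
      rcases ih with hzr | ⟨hu', hzr⟩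
      · exact Or.inl (hadj'.reachable.trans hzr)
      · refine Or.inr ⟨?_, hzr⟩
        rcases hu' with h1 | h1
        · exact Or.inl (hadj'.reachable.trans h1)
        · exact Or.inr (hadj'.reachable.trans h1)

/-- Conversely, a vertex joined in `ω` to `v` or to `x` is joined to `v` in `insert s(v,x) ω`
(`v ≠ x`). [folklore] -/
theorem knConj6Two_reachable_insert_of (ω : BondConfig V) {v x b : V} (hvx : v ≠ x)
    (h : (openGraph ω).Reachable v b ∨ (openGraph ω).Reachable x b) :
    (openGraph (insert s(v, x) ω)).Reachable v b := by
  have hmono : openGraph ω ≤ openGraph (insert s(v, x) ω) := openGraph_mono (Set.subset_insert _ _)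
  rcases h with h | h
  · exact h.mono hmono
  · have hadj : (openGraph (insert s(v, x) ω)).Adj v x :=
      (openGraph_adj _ v x).2 ⟨Set.mem_insert _ _, hvx⟩
    exact hadj.reachable.trans (h.mono hmono)

end GraphLemmas

section Indicators

variable {α : Type*}

/-- `1_s ⊔ 1_t = 1_{s ∪ t}` pointwise. [folklore] -/
theorem knConj6Two_indicator_sup (s t : Set α) (ω : α) :
    s.indicator (1 : α → ℝ) ω ⊔ t.indicator 1 ω = (s ∪ t).indicator 1 ω := by
  by_cases hs : ω ∈ s <;> by_cases ht : ω ∈ t <;>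
    simp [Set.indicator_of_mem, Set.indicator_of_notMem, hs, ht]

/-- `1 - 1_s = 1_{sᶜ}` pointwise. [folklore] -/
theorem knConj6Two_one_sub_indicator (s : Set α) (ω : α) :
    1 - s.indicator (1 : α → ℝ) ω = sᶜ.indicator 1 ω := by
  by_cases hs : ω ∈ s <;> simp [Set.indicator_of_mem, Set.indicator_of_notMem, hs]

/-- `1_s · 1_t = 1_{s ∩ t}` pointwise. [folklore] -/
theorem knConj6Two_indicator_mul (s t : Set α) (ω : α) :
    s.indicator (1 : α → ℝ) ω * t.indicator 1 ω = (s ∩ t).indicator 1 ω :=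
  (congrFun (Set.inter_indicator_one (s := s) (t := t) (M₀ := ℝ)) ω).symm

/-- `∫_D 1_E dμ = μ(D ∩ E)` on a discrete space. [folklore] -/
theorem knConj6Two_setIntegral_indicator_one [MeasurableSpace α] [DiscreteMeasurableSpace α]
    (μ : Measure α) [IsFiniteMeasure μ] (D E : Set α) :
    ∫ ω in D, E.indicator (1 : α → ℝ) ω ∂μ = μ.real (D ∩ E) := by
  rw [setIntegral_indicator (MeasurableSet.of_discrete (s := E))]
  simp only [Pi.one_apply, setIntegral_const, smul_eq_mul, mul_one]

end Indicators

variable {n : ℕ}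

section BHKChain

variable {V : Type*}

/-- `F_a(C) ≤ 1`. [folklore] -/
theorem knConj6Two_connIndicatorFn_le_one (s a : V) (C : Set (Sym2 V)) :
    connIndicatorFn s a C ≤ 1 := by
  unfold connIndicatorFn; split_ifs <;> norm_num

end BHKChain

/-- **The exchange inequality behind Conjecture 6 for two relays.**  With `D = {a₀ ↮ a₁}`,
`H = {a₁ ↔ v} ∪ {a₁ ↔ x}` and `Q = {a₀ ↔ v} ∪ {a₀ ↔ x}`: if `μ(a₀ ↔ b) ≤ μ(a₁ ↔ b)` then
`μ(D ∩ {a₀ ↔ b} ∩ H ∩ Qᶜ) ≤ μ(D ∩ {a₁ ↔ b} ∩ H ∩ Qᶜ)`.  Proof: off `D` the events `{a₀ ↔ b}`,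
`{a₁ ↔ b}` agree, so `μ(D ∩ {a₀ ↔ b}) ≤ μ(D ∩ {a₁ ↔ b})`; then two applications of
van den Berg–Häggström–Kahn 2006 Thm 1.5 (`BHK2006_twoClusterConditionalAssociation_holds`) with the
functions `1{aᵢ ↔ b}` and `1_H(C_{a₁}) · 1_{Qᶜ}(C_{a₀})` (increasing in `C_{a₁}`, decreasing in
`C_{a₀}`): negative correlation with `1{a₀ ↔ b}` and positive association with `1{a₁ ↔ b}`
given `D`. [cite: VandenbergHaggstromKahn2005, Thm. 1.5] -/
theorem knConj6Two_bhk_chain (w : Sym2 (Fin n) → unitInterval) (a₀ a₁ b v x : Fin n)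
    (h01 : a₀ ≠ a₁)
    (hmin : (prodBernoulli w).real (openConn a₀ b) ≤ (prodBernoulli w).real (openConn a₁ b)) :
    (prodBernoulli w).real ((openConn a₀ a₁)ᶜ ∩ (openConn a₀ b ∩
        ((openConn a₁ v ∪ openConn a₁ x) ∩ (openConn a₀ v ∪ openConn a₀ x)ᶜ))) ≤
      (prodBernoulli w).real ((openConn a₀ a₁)ᶜ ∩ (openConn a₁ b ∩
        ((openConn a₁ v ∪ openConn a₁ x) ∩ (openConn a₀ v ∪ openConn a₀ x)ᶜ))) := by
  set D : Set (BondConfig (Fin n)) := (openConn a₀ a₁)ᶜ with hDdef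
  set HQ : Set (BondConfig (Fin n)) :=
    (openConn a₁ v ∪ openConn a₁ x) ∩ (openConn a₀ v ∪ openConn a₀ x)ᶜ with hHQdef
  -- the two auxiliary functions of an edge set
  set hf : Set (Sym2 (Fin n)) → ℝ := fun C => connIndicatorFn a₁ v C ⊔ connIndicatorFn a₁ x C
    with hhf
  set qf : Set (Sym2 (Fin n)) → ℝ :=
    fun C => 1 - (connIndicatorFn a₀ v C ⊔ connIndicatorFn a₀ x C) with hqf
  have hhf_mono : Monotone hf :=
    (monotone_connIndicatorFn a₁ v).sup (monotone_connIndicatorFn a₁ x)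
  have hqf_anti : Antitone qf := by
    intro C C' hCC'
    have hle := ((monotone_connIndicatorFn a₀ v).sup (monotone_connIndicatorFn a₀ x)) hCC'
    simp only [hqf]
    simp only [Pi.sup_apply] at hle
    linarith
  have hhf_nn : ∀ C, 0 ≤ hf C := fun C =>
    le_sup_of_le_left (PocketBHK.connIndicatorFn_nonneg a₁ v C)
  have hqf_nn : ∀ C, 0 ≤ qf C := fun C => by
    have h1 : connIndicatorFn a₀ v C ⊔ connIndicatorFn a₀ x C ≤ 1 :=
      sup_le (knConj6Two_connIndicatorFn_le_one a₀ v C) (knConj6Two_connIndicatorFn_le_one a₀ x C)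
    simp only [hqf]
    linarith
  -- evaluation at the clusters
  have hHQ_eval : ∀ ω : BondConfig (Fin n),
      hf (openEdgeCluster ω a₁) * qf (openEdgeCluster ω a₀) = HQ.indicator 1 ω := by
    intro ω
    simp only [hhf, hqf, hHQdef, connIndicatorFn_openEdgeCluster, knConj6Two_indicator_sup,
      knConj6Two_one_sub_indicator, knConj6Two_indicator_mul]
  have hDset : {ω : BondConfig (Fin n) | ¬ (openGraph ω).Reachable a₀ a₁} = D := rfl
  have hD'set : {ω : BondConfig (Fin n) | ¬ (openGraph ω).Reachable a₁ a₀} = D :=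
    Set.ext fun ω => ⟨fun h h' => h (SimpleGraph.Reachable.symm h'),
      fun h h' => h (SimpleGraph.Reachable.symm h')⟩
  -- BHK, negative correlation of `1{a₀ ↔ b}` (in `C_{a₀}`) with `hf(C_{a₁}) qf(C_{a₀})` given `D`
  have key1 := BHK2006_twoClusterConditionalAssociation_holds (Fin n) w a₀ a₁
    (fun C _ => connIndicatorFn a₀ b C) (fun C C' => -(hf C' * qf C))
    (fun _ => monotone_connIndicatorFn a₀ b) (fun _ => antitone_const)
    (fun C' C₁ C₂ hC => neg_le_neg (mul_le_mul_of_nonneg_left (hqf_anti hC) (hhf_nn C')))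
    (fun C C₁ C₂ hC => neg_le_neg (mul_le_mul_of_nonneg_right (hhf_mono hC) (hqf_nn C))) h01
  simp only [connIndicatorFn_openEdgeCluster, hHQ_eval, mul_neg, knConj6Two_indicator_mul,
    integral_neg, knConj6Two_setIntegral_indicator_one, hDset] at key1
  -- BHK, positive association of `1{a₁ ↔ b}` with `hf(C_{a₁}) qf(C_{a₀})` given `D`
  have key2 := BHK2006_twoClusterConditionalAssociation_holds (Fin n) w a₁ a₀
    (fun C _ => connIndicatorFn a₁ b C) (fun C C' => hf C * qf C')
    (fun _ => monotone_connIndicatorFn a₁ b) (fun _ => antitone_const)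
    (fun C' C₁ C₂ hC => mul_le_mul_of_nonneg_right (hhf_mono hC) (hqf_nn C'))
    (fun C C₁ C₂ hC => mul_le_mul_of_nonneg_left (hqf_anti hC) (hhf_nn C)) h01.symm
  simp only [connIndicatorFn_openEdgeCluster, hHQ_eval, knConj6Two_indicator_mul,
    knConj6Two_setIntegral_indicator_one, hD'set] at key2
  -- off `D` the two connection events agree
  have hA : (prodBernoulli w).real (D ∩ openConn a₀ b) ≤
      (prodBernoulli w).real (D ∩ openConn a₁ b) := by
    have e0 := measureReal_inter_add_sdiff (μ := prodBernoulli w) (s := openConn a₀ b) (t := D)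
      MeasurableSet.of_discrete
    have e1 := measureReal_inter_add_sdiff (μ := prodBernoulli w) (s := openConn a₁ b) (t := D)
      MeasurableSet.of_discrete
    have hsd : (openConn a₀ b : Set (BondConfig (Fin n))) \ D = openConn a₁ b \ D := by
      ext ω
      simp only [hDdef, Set.mem_sdiff, Set.mem_compl_iff, not_not]
      constructor
      · rintro ⟨hb, h⟩
        exact ⟨SimpleGraph.Reachable.trans (SimpleGraph.Reachable.symm h) hb, h⟩
      · rintro ⟨hb, h⟩
        exact ⟨SimpleGraph.Reachable.trans h hb, h⟩
    rw [hsd] at e0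
    rw [Set.inter_comm D, Set.inter_comm D]
    linarith
  -- assemble
  by_cases hm : (prodBernoulli w).real D = 0
  · calc (prodBernoulli w).real (D ∩ (openConn a₀ b ∩ HQ))
        ≤ (prodBernoulli w).real D := measureReal_mono Set.inter_subset_left
      _ ≤ _ := by rw [hm]; exact measureReal_nonneg
  · have hpos : 0 < (prodBernoulli w).real D := lt_of_le_of_ne measureReal_nonneg (Ne.symm hm)
    refine le_of_mul_le_mul_left ?_ hpos
    have hHQnn : 0 ≤ (prodBernoulli w).real (D ∩ HQ) := measureReal_nonneg
    calc (prodBernoulli w).real D * (prodBernoulli w).real (D ∩ (openConn a₀ b ∩ HQ))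
        ≤ (prodBernoulli w).real (D ∩ openConn a₀ b) * (prodBernoulli w).real (D ∩ HQ) := by
          linarith
      _ ≤ (prodBernoulli w).real (D ∩ openConn a₁ b) * (prodBernoulli w).real (D ∩ HQ) :=
          mul_le_mul_of_nonneg_right hA hHQnn
      _ ≤ (prodBernoulli w).real D * (prodBernoulli w).real (D ∩ (openConn a₁ b ∩ HQ)) := key2


/-- **KN Conjecture 6 for two relays, glued form.**  For `v ≠ x`, `a₀ ≠ a₁`, every `a ∈ A` equal
to `a₀` or `a₁`, and `μ_w(a₀ ↔ b) ≤ μ_w(a₁ ↔ b)`: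
`μ'(v ↔ A) · μ'(a₀ ↔ b) ≤ μ'(v ↔ b)` for `μ' = prodBernoulli (w[s(v,x) ↦ 1])`.
Transfer to `μ_w` along `ω ↦ insert s(v,x) ω`, Harris for the increasing events
`SA = {S ↔ a₀} ∪ {S ↔ a₁}` and `G₀ = {a₀ ↔ b} ∪ ({S ↔ a₀} ∩ {S ↔ b})` (`S = {v, x}`), and the
exchange inequality `knConj6Two_bhk_chain`. [cite: KozmaNitzan2024, Conjecture 6 (§5.3 p. 34), case |A| = 2] -/
theorem knConj6Two_glued (w : Sym2 (Fin n) → unitInterval) (A : Finset (Fin n))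
    (b v x a₀ a₁ : Fin n) (hvx : v ≠ x) (h01 : a₀ ≠ a₁) (hA : ∀ a ∈ A, a = a₀ ∨ a = a₁)
    (hmin : (prodBernoulli w).real (openConn a₀ b) ≤ (prodBernoulli w).real (openConn a₁ b)) :
    (prodBernoulli (Function.update w s(v, x) 1)).real (⋃ a ∈ A, openConn v a) *
        (prodBernoulli (Function.update w s(v, x) 1)).real (openConn a₀ b) ≤
      (prodBernoulli (Function.update w s(v, x) 1)).real (openConn v b) := by
  have hchain := knConj6Two_bhk_chain w a₀ a₁ b v x h01 hmin
  set U₀ : Set (BondConfig (Fin n)) := openConn a₀ v ∪ openConn a₀ x with hU₀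
  set H : Set (BondConfig (Fin n)) := openConn a₁ v ∪ openConn a₁ x with hH
  set D : Set (BondConfig (Fin n)) := (openConn a₀ a₁)ᶜ with hD
  set SA : Set (BondConfig (Fin n)) := U₀ ∪ H with hSA
  set Sb : Set (BondConfig (Fin n)) := openConn v b ∪ openConn x b with hSb
  set G₀ : Set (BondConfig (Fin n)) := openConn a₀ b ∪ (U₀ ∩ (openConn b v ∪ openConn b x))
    with hG₀
  -- Step 1: transfer the three glued probabilities to `μ_w`
  have hY : (prodBernoulli (Function.update w s(v, x) 1)).real (⋃ a ∈ A, openConn v a) ≤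
      (prodBernoulli w).real SA := by
    rw [tieLiftTwo_real_update_one]
    refine measureReal_mono (fun ω hω => ?_)
    simp only [Set.mem_preimage, Set.mem_iUnion, exists_prop] at hω
    obtain ⟨a, haA, ha⟩ := hω
    rcases hA a haA with ha0 | ha1
    · rw [ha0] at ha
      rcases knConj6Two_reachable_insert ω v x a₀ ha with h | ⟨_, h⟩
      · exact Or.inl (Or.inl (SimpleGraph.Reachable.symm h))
      · exact Or.inl h
    · rw [ha1] at ha
      rcases knConj6Two_reachable_insert ω v x a₁ ha with h | ⟨_, h⟩
      · exact Or.inr (Or.inl (SimpleGraph.Reachable.symm h))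
      · exact Or.inr h
  have hZ : (prodBernoulli (Function.update w s(v, x) 1)).real (openConn a₀ b) ≤
      (prodBernoulli w).real G₀ := by
    rw [tieLiftTwo_real_update_one]
    refine measureReal_mono (fun ω hω => ?_)
    rw [Set.mem_preimage] at hω
    rcases knConj6Two_reachable_insert ω v x b hω with h | h
    · exact Or.inl h
    · exact Or.inr h
  have hX : (prodBernoulli w).real Sb ≤
      (prodBernoulli (Function.update w s(v, x) 1)).real (openConn v b) := by
    rw [tieLiftTwo_real_update_one]
    refine measureReal_mono (fun ω hω => ?_)
    rw [Set.mem_preimage]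
    exact knConj6Two_reachable_insert_of ω hvx hω
  -- Step 2: Harris
  have hSAu : IsUpperSet SA :=
    ((isUpperSet_openConn a₀ v).union (isUpperSet_openConn a₀ x)).union
      ((isUpperSet_openConn a₁ v).union (isUpperSet_openConn a₁ x))
  have hG₀u : IsUpperSet G₀ :=
    (isUpperSet_openConn a₀ b).union
      (((isUpperSet_openConn a₀ v).union (isUpperSet_openConn a₀ x)).inter
        ((isUpperSet_openConn b v).union (isUpperSet_openConn b x)))
  have hHarris := prodBernoulli_harris w hSAu hG₀u MeasurableSet.of_discrete
    MeasurableSet.of_discrete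
  -- Step 3: the exchange `μ(SA ∩ G₀) ≤ μ(SA ∩ Sb)`
  have hN : (SA ∩ G₀) \ Sb ⊆ D ∩ (openConn a₀ b ∩ (H ∩ U₀ᶜ)) := by
    rintro ω ⟨⟨hSA', hG₀'⟩, hSb'⟩
    have hvb : ¬ (openGraph ω).Reachable v b := fun h => hSb' (Or.inl h)
    have hxb : ¬ (openGraph ω).Reachable x b := fun h => hSb' (Or.inr h)
    have hab : (openGraph ω).Reachable a₀ b := by
      rcases hG₀' with h | ⟨_, h | h⟩
      · exact h
      · exact absurd (SimpleGraph.Reachable.symm h) hvb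
      · exact absurd (SimpleGraph.Reachable.symm h) hxb
    have hU : ω ∉ U₀ := by
      rintro (h | h)
      · exact hvb ((SimpleGraph.Reachable.symm h).trans hab)
      · exact hxb ((SimpleGraph.Reachable.symm h).trans hab)
    have hHω : ω ∈ H := hSA'.resolve_left hU
    refine ⟨fun h01' => ?_, hab, hHω, hU⟩
    rcases hHω with h | h
    · exact hU (Or.inl (SimpleGraph.Reachable.trans h01' h))
    · exact hU (Or.inr (SimpleGraph.Reachable.trans h01' h))
  have hM : D ∩ (openConn a₁ b ∩ (H ∩ U₀ᶜ)) ⊆ SA ∩ Sb := by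
    rintro ω ⟨_, hb1, hHω, _⟩
    refine ⟨Or.inr hHω, ?_⟩
    rcases hHω with h | h
    · exact Or.inl ((SimpleGraph.Reachable.symm h).trans hb1)
    · exact Or.inr ((SimpleGraph.Reachable.symm h).trans hb1)
  have hdisj : Disjoint ((SA ∩ G₀) ∩ Sb) (D ∩ (openConn a₁ b ∩ (H ∩ U₀ᶜ))) := by
    rw [Set.disjoint_left]
    rintro ω ⟨⟨_, hG₀'⟩, _⟩ ⟨hD', hb1, _, hU⟩
    rcases hG₀' with h | ⟨h, _⟩
    · exact hD' (SimpleGraph.Reachable.trans h (SimpleGraph.Reachable.symm hb1))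
    · exact hU h
  have h1 := measureReal_inter_add_sdiff (μ := prodBernoulli w) (s := SA ∩ G₀) (t := Sb)
    MeasurableSet.of_discrete
  have h2 : (prodBernoulli w).real ((SA ∩ G₀) \ Sb) ≤
      (prodBernoulli w).real (D ∩ (openConn a₀ b ∩ (H ∩ U₀ᶜ))) := measureReal_mono hN
  have h3 : (prodBernoulli w).real ((SA ∩ G₀) ∩ Sb) +
      (prodBernoulli w).real (D ∩ (openConn a₁ b ∩ (H ∩ U₀ᶜ))) ≤
      (prodBernoulli w).real (SA ∩ Sb) := by
    rw [← measureReal_union hdisj MeasurableSet.of_discrete]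
    exact measureReal_mono (Set.union_subset (fun ω hω => ⟨hω.1.1, hω.2⟩) hM)
  have h4 : (prodBernoulli w).real (SA ∩ Sb) ≤ (prodBernoulli w).real Sb :=
    measureReal_mono Set.inter_subset_right
  -- assemble
  calc (prodBernoulli (Function.update w s(v, x) 1)).real (⋃ a ∈ A, openConn v a) *
        (prodBernoulli (Function.update w s(v, x) 1)).real (openConn a₀ b)
      ≤ (prodBernoulli w).real SA * (prodBernoulli w).real G₀ :=
        mul_le_mul hY hZ measureReal_nonneg measureReal_nonneg
    _ ≤ (prodBernoulli w).real (SA ∩ G₀) := hHarris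
    _ ≤ (prodBernoulli w).real (SA ∩ Sb) := by linarith
    _ ≤ (prodBernoulli w).real Sb := h4
    _ ≤ (prodBernoulli (Function.update w s(v, x) 1)).real (openConn v b) := hX

/-- TTRL-lite variant V2455 of `stub_shorteningStep` (stmt-CriticalPhenomena-4574; Kozma–Nitzan
arXiv:2401.12397 Conjecture 6, §5.3 p. 34, with Lemma 13's induction hypothesis displayed): the
shortening step for a relay set with `A.card = 2` (and `n ≤ 5`, unused).  Writing `A = {a₀, a₁}`,
this is `knConj6Two_glued`: transfer to the unglued measure along `ω ↦ insert s(v,x) ω`, Harris,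
and a two-cluster BHK exchange driven by the minimiser hypothesis `μ_w(a₀ ↔ b) ≤ μ_w(a₁ ↔ b)`.
The hypotheses `n ≤ 5`, `v ∉ A`, `w s(v,x) = 0` and the induction hypothesis are not used. -/
theorem stub_shorteningStep_var2455 : ∀ (n : ℕ) (w : Sym2 (Fin n) → unitInterval) (A : Finset (Fin n)) (b v x a₀ : Fin n), A.card = 2 → n ≤ 5 → v ∉ A → v ≠ x → w s(v, x) = 0 → a₀ ∈ A → (∀ a ∈ A, (prodBernoulli w).real (openConn a₀ b) ≤ (prodBernoulli w).real (openConn a b)) → (∀ w' : Sym2 (Fin n) → unitInterval, (∀ e, w e = 0 → w' e = 0) → ∀ (A' : Finset (Fin n)) (o' b' : Fin n) (t : ℝ), (∀ a ∈ A', t ≤ (prodBernoulli w').real (openConn a b')) → (prodBernoulli w').real (⋃ a ∈ A', openConn o' a) * t ≤ (prodBernoulli w').real (openConn o' b')) → (prodBernoulli (Function.update w s(v, x) 1)).real (⋃ a ∈ A, openConn v a) * (prodBernoulli (Function.update w s(v, x) 1)).real (openConn a₀ b) ≤ (prodBernoulli (Function.update w s(v, x) 1)).real (openConn v b) := by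
  intro n w A b v x a₀ hA _hn _hvA hvx _hw0 ha₀ hmin _hIH
  obtain ⟨p, q, hpq, rfl⟩ := Finset.card_eq_two.1 hA
  have hmem : ∀ a ∈ ({p, q} : Finset (Fin n)), a = p ∨ a = q := fun a ha => by
    simpa only [Finset.mem_insert, Finset.mem_singleton] using ha
  rcases hmem a₀ ha₀ with h0 | h0
  · refine knConj6Two_glued w {p, q} b v x a₀ q hvx (fun h => hpq (h0.symm.trans h)) ?_
      (hmin q (Finset.mem_insert_of_mem (Finset.mem_singleton_self q)))
    intro a ha
    rcases hmem a ha with rfl | rfl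
    · exact Or.inl h0.symm
    · exact Or.inr rfl
  · refine knConj6Two_glued w {p, q} b v x a₀ p hvx (fun h => hpq (h.symm.trans h0)) ?_
      (hmin p (Finset.mem_insert_self p {q}))
    intro a ha
    rcases hmem a ha with rfl | rfl
    · exact Or.inr rfl
    · exact Or.inl h0.symm

end Summit.CriticalPhenomena.PercolationContinuityZ3.Theorems
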